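import Summits.CriticalPhenomena.SAWScalingLimit.Theorems.SAWDevelopingMapInteriorFlatteningLiouvilleCoherenceBridge
import Summits.CriticalPhenomena.SAWScalingLimit.Theorems.SAWDevelopingMapInteriorFlatteningLiouvilleReduction
import Summits.CriticalPhenomena.SAWScalingLimit.Theorems.SAWDevelopingMapInteriorFlatteningReentryFixedRadius

/-!
# Bridge: the windowed intrusion tail (S6') of line `liouville-local-limits` from two named arm estimates

Crux `stmt-CriticalPhenomena-8297` (`…Theses.SAWDevelopingMap.InteriorFlattening`), line `liouville-local-limits`,
registered stub S6' `stub_intrusionTail` (windowed, `N`-normalised, reshape r4 of the lead's skeleton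
`Cruxes/InteriorFlattening/Lines/liouville_local_limits.lean`):

  for `1 ≤ r ≤ s̄`, `δ > 0` and `S ≥ S₂(r, s̄, δ)`, in the window `B_{2S}(O) ⊆ Λ ⊉ B_{4S}(O)`,
  `Σ_{P ∈ Pic S, ¬ Clean s̄ P} ‖amp P‖ · Σ_{e ∈ innerEdges r} ‖F_P(e)‖ ≤ δ · Σ_{P ∈ Pic S} ‖amp P‖ ‖m_S(P)‖`.

The stub is research-level OPEN (a three-arm re-entry estimate for the critical `x_c`-weighted planar SAW with
COHERENT far amplitudes; no RSW/BK/separation technology exists at `n = 0`) and is NOT proved here. This file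

* scrutinises nothing away: the signature is formally sound (both sides carry `‖amp‖`, so a root disconnected
  from the ball gives `0 ≤ 0`; a dart head inside the intrusion set kills the inner field on both sides,
  `Reduction.picField_eq_zero_of_mem`; `S₂` is free, so only `S ≥ s̄ ≥ r ≥ 1` matters; dead-at-`O` dirty
  pictures — a crosscut through `B_r(O)` separating the dart from `O` — are alive on the far side of
  `innerEdges r`, which is why the inner quantity below is the mass to ALL of `innerEdges r`, not to the three
  ports of `O` only);
* NAMES, as `def PictureReentryGap (ρ : ℝ) : Prop` over the objects of `…LiouvilleDefs`, the one missing estimate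
  (E1'): in the window, pictures unclean at radius `t ∈ [r, S]` carry at most `C_r (t/S)^ρ` of the coherent port
  weight `Σ_P ‖amp P‖ · portMass P`, when weighted by the unsigned inner mass to the edges of `B_r(O)` — the
  picture-coordinate twin, with `B_r`-targets, of the sibling line's `OneMouth.CoherentReentryGap` (E1); heuristic
  `ρ = x₃ − x₁ = 77/48 − 5/48 = 3/2` (Duplantier–Saleur watermelon exponents, non-rigorous);
* kernel-checks `intrusionTail_of_armEstimates`: S6' (its registered signature, verbatim) FOLLOWS from
  `PictureReentryGap ρ` and the sibling line's named no-cancellation estimate `OneMouth.CleanMonopoleLowerBound κ`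
  (E2, `…OneMouthEstimates`; heuristic `κ = 25/48`) whenever `0 ≤ κ < ρ`, both entering ONLY AS HYPOTHESES.

Proof: `‖F_P(e)‖ ≤ edgeMass` termwise; E1' at `t = s̄` bounds the left side by `C (s̄/S)^ρ Σ‖amp‖·portMass`;
`portMass ≤ 3·innerMass` (`r ≥ 1`: the star of `O` lies in `innerEdges r`) and E1' at `t = θS` with
`3Cθ^ρ ≤ 1/2` show that the pictures clean at `θS` carry half of `Σ‖amp‖·portMass`; on those, E2 (re-indexed to
pictures by `(I, d) ↦ (B_S ∖ I, d)`, `CoherenceBridge.amp_toPic`; realisable pictures have their dart tail in `Λ`)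
converts `portMass` into `‖m_S‖` at the price `c₀⁻¹ S^κ`; total `2 C c₀⁻¹ s̄^ρ S^{κ-ρ} → 0`. Exponent margin in the
heuristics: `ρ − κ = 47/48`.
-/

noncomputable section

open scoped BigOperators Classical Topology
open Filter Literature.Probability.LatticeModels Literature.Probability.RandomPlanarGeometry.SAW

namespace Summit.CriticalPhenomena.SAWScalingLimit.Theorems.InteriorFlattening.Liouville

/-! ### Unsigned inner masses of a (domain-free) picture domain -/

/-- The unsigned `x_c`-mass of the inner walks of the picture domain `B_S(O) ∖ P.1` from its dart to the
mid-edge `e` (the triangle-inequality majorant of `‖picField S P e‖`). -/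
def edgeMass (S : ℝ) (P : Picture) (e : Sym2 HexVertex) : ℝ :=
  ∑ γ : HexMidEdgeSAW (latticeBall S \ P.1) (picRoot P) e, xc ^ γ.length

/-- The unsigned inner mass to the comparison set: `Σ_{e ∈ innerEdges r} edgeMass S P e`. -/
def innerMass (r S : ℝ) (P : Picture) : ℝ :=
  ∑ e ∈ innerEdges r, edgeMass S P e

/-- The unsigned inner mass to the three ports of `O` (literally `OneMouth.pmass` of the picture domain). -/
def portMass (S : ℝ) (P : Picture) : ℝ :=
  edgeMass S P s(O, nbA) + edgeMass S P s(O, nbB) + edgeMass S P s(O, nbC)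

/-- **E1' — coherent re-entry (three-arm) gap in picture coordinates, with `B_r(O)`-targets** (NOT asserted;
open). For every comparison radius `r ≥ 1` there are `C ≥ 0` and `S₀` such that for `S ≥ S₀`, `r ≤ t ≤ S`, in
the window `B_{2S}(O) ⊆ Λ ⊉ B_{4S}(O)`: the pictures of `Pic S` unclean at radius `t` (intrusions meeting
`B_t(O)`: a prefix strand in and out across `A(t, S)` plus the final strand to `B_r(O)` — three arms), weighted
by `‖amp‖` times the unsigned inner mass to the edges of `B_r(O)`, carry at most `C (t/S)^ρ` of the coherent
port weight `Σ_P ‖amp P‖ · portMass P`. The far amplitude is kept COHERENT (`‖Σ_prefixes e^{-iσW} x_c^ℓ‖`) on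
both sides, as in the sibling line's `OneMouth.CoherentReentryGap`; heuristic `ρ = x₃ − x₁ = 3/2`. -/
def PictureReentryGap (ρ : ℝ) : Prop :=
  ∀ r : ℝ, 1 ≤ r → ∃ C : ℝ, 0 ≤ C ∧ ∃ S₀ : ℝ, ∀ S : ℝ, S₀ ≤ S → ∀ t : ℝ, r ≤ t → t ≤ S →
    ∀ (Λ : Finset HexVertex) (a : Sym2 HexVertex),
      hexDomainSimplyConnected Λ → a ∈ hexDomainBoundary Λ → Deep Λ O (2 * S) → ¬ Deep Λ O (4 * S) →
        ∑ P ∈ (Pic S).filter (fun P => ¬ Clean t P), ‖amp Λ a S P‖ * innerMass r S P ≤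
          C * (t / S) ^ ρ * ∑ P ∈ Pic S, ‖amp Λ a S P‖ * portMass S P

namespace IntrusionBridge

/-! ### Elementary glue -/

/-- `edgeMass ≥ 0` (a sum of powers of `x_c ≥ 0`). -/
theorem edgeMass_nonneg (S : ℝ) (P : Picture) (e : Sym2 HexVertex) : 0 ≤ edgeMass S P e := by
  unfold edgeMass
  have := OneMouth.xc_nonneg
  positivity

/-- `innerMass ≥ 0`. -/
theorem innerMass_nonneg (r S : ℝ) (P : Picture) : 0 ≤ innerMass r S P :=
  Finset.sum_nonneg fun e _ => edgeMass_nonneg S P e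

/-- `portMass ≥ 0`. -/
theorem portMass_nonneg (S : ℝ) (P : Picture) : 0 ≤ portMass S P := by
  unfold portMass
  have h1 := edgeMass_nonneg S P s(O, nbA)
  have h2 := edgeMass_nonneg S P s(O, nbB)
  have h3 := edgeMass_nonneg S P s(O, nbC)
  linarith

/-- `‖F_P(e)‖ ≤ edgeMass` (triangle inequality; the winding factors are unimodular). -/
theorem norm_picField_le_edgeMass (S : ℝ) (P : Picture) (e : Sym2 HexVertex) :
    ‖picField S P e‖ ≤ edgeMass S P e :=
  norm_hexParafermionicObservable_le _ _ OneMouth.xc_nonneg _ _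

/-- A single edge mass of the comparison set is at most the inner mass. -/
theorem edgeMass_le_innerMass {r S : ℝ} {P : Picture} {e : Sym2 HexVertex} (he : e ∈ innerEdges r) :
    edgeMass S P e ≤ innerMass r S P :=
  Finset.single_le_sum (f := fun e' => edgeMass S P e') (fun e' _ => edgeMass_nonneg S P e') he

/-- For `r ≥ 1` the star of `O` lies in `innerEdges r`, so `portMass ≤ 3 · innerMass`. -/
theorem portMass_le_innerMass {r : ℝ} (hr : 1 ≤ r) (S : ℝ) (P : Picture) :
    portMass S P ≤ 3 * innerMass r S P := by
  have hA := edgeMass_le_innerMass (S := S) (P := P) (Reduction.star_mem_innerEdges hr Reduction.adj_O_nbA)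
  have hB := edgeMass_le_innerMass (S := S) (P := P) (Reduction.star_mem_innerEdges hr Reduction.adj_O_nbB)
  have hC := edgeMass_le_innerMass (S := S) (P := P) (Reduction.star_mem_innerEdges hr Reduction.adj_O_nbC)
  unfold portMass
  linarith

/-! ### Re-indexing the sibling line's clean monopole lower bound (E2) to pictures -/

/-- **E2 on a picture.** If the one-mouth clean monopole lower bound holds at `(Λ, a)`, centre `O`, radius
`S`, aspect `θ`, then every realisable picture `P ∈ Pic S` (`amp ≠ 0`) clean at `θ S` has
`c₀ S^{-κ} · portMass P ≤ ‖m_S(P)‖`: the configuration `(B_S ∖ P.1, P.2)` of the sub-ball `ball Λ O S = B_S(O)`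
has the same far amplitude (`CoherenceBridge.amp_toPic`), the same inner domain, root, ports. -/
theorem cleanMonopole_toPic {κ θ c₀ S : ℝ} {Λ : Finset HexVertex} {a : Sym2 HexVertex}
    (hE : ∀ c ∈ OneMouth.Conf Λ (OneMouth.ball Λ O S), OneMouth.amp Λ a (OneMouth.ball Λ O S) c ≠ 0 →
      OneMouth.Clean (OneMouth.ball Λ O S) c.1 O (θ * S) →
        c₀ * S ^ (-κ) * OneMouth.pmass c.1 (OneMouth.root c) O nbA nbB nbC ≤
          ‖OneMouth.mono c.1 (OneMouth.root c) O nbA nbB nbC‖)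
    (hball : latticeBall S ⊆ Λ) {P : Picture} (hP : P ∈ Pic S) (hamp : amp Λ a S P ≠ 0)
    (hcl : Clean (θ * S) P) :
    c₀ * S ^ (-κ) * portMass S P ≤ ‖picMono S P‖ := by
  obtain ⟨I, y, z⟩ := P
  have hinter : Λ ∩ latticeBall S = latticeBall S := Finset.inter_eq_right.2 hball
  have hballeq : OneMouth.ball Λ O S = latticeBall S := by rw [CoherenceBridge.ball_eq, hinter]
  obtain ⟨hI, -, hyS, hzS, hadj⟩ := Reduction.of_mem_Pic hP
  have hy : y ∈ Λ := by
    by_contra h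
    exact hamp (LastExit.amp_eq_zero (Or.inl h))
  have hc : ((latticeBall S \ I, (y, z)) : OneMouth.Config) ∈ OneMouth.Conf Λ (OneMouth.ball Λ O S) := by
    rw [hballeq]
    simp only [OneMouth.Conf, OneMouth.entr, Finset.mem_product, Finset.mem_powerset, Finset.mem_filter]
    exact ⟨Finset.sdiff_subset, ⟨hy, hzS⟩, hyS, hadj⟩
  have hampc : OneMouth.amp Λ a (OneMouth.ball Λ O S) (latticeBall S \ I, (y, z)) ≠ 0 := by
    rw [hballeq]
    have h := CoherenceBridge.amp_toPic (Λ := Λ) (S' := latticeBall S) (D' := latticeBall S \ I) (a := a)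
      (S := S) (d := (y, z)) hinter.symm Finset.sdiff_subset
    rw [Finset.sdiff_sdiff_eq_self hI] at h
    rwa [← h]
  have hclc : OneMouth.Clean (OneMouth.ball Λ O S) (latticeBall S \ I) O (θ * S) := by
    rw [hballeq]
    intro w hw hdist
    exact Finset.mem_sdiff.2 ⟨hw, fun hwI => Finset.disjoint_left.1 hcl hwI (mem_latticeBall_iff.2 hdist)⟩
  have key := hE _ hc hampc hclc
  exact key

end IntrusionBridge

open IntrusionBridge

/-- **S6' ⇐ E1' + E2 (conditional reduction; the estimates are hypotheses, not asserted).** For `0 ≤ κ < ρ`,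
`PictureReentryGap ρ` and `OneMouth.CleanMonopoleLowerBound κ` imply the windowed, `N`-normalised intrusion tail
— the registered signature of `stub_intrusionTail`, verbatim — with `S₂ = S₂(r, s̄, δ)` such that
`2 C c₀⁻¹ s̄^ρ S^{κ-ρ} < δ` beyond it (`θ` chosen with `3 C θ^ρ ≤ 1/2`). -/
theorem intrusionTail_of_armEstimates :
    ∀ ρ κ : ℝ, 0 ≤ κ → κ < ρ → PictureReentryGap ρ → OneMouth.CleanMonopoleLowerBound κ →
      ∀ r : ℝ, 1 ≤ r → ∀ sbar : ℝ, r ≤ sbar → ∀ δ : ℝ, 0 < δ → ∃ S₂ : ℝ, ∀ S : ℝ, S₂ ≤ S →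
        ∀ (Λ : Finset HexVertex) (a : Sym2 HexVertex),
          hexDomainSimplyConnected Λ → a ∈ hexDomainBoundary Λ → Deep Λ O (2 * S) → ¬ Deep Λ O (4 * S) →
            ∑ P ∈ (Pic S).filter (fun P => ¬ Clean sbar P),
                ‖amp Λ a S P‖ * ∑ e ∈ innerEdges r, ‖picField S P e‖ ≤
              δ * ∑ P ∈ Pic S, ‖amp Λ a S P‖ * ‖picMono S P‖ := by
  intro ρ κ hκ hκρ hA hE2 r hr sbar hsbar δ hδ
  obtain ⟨C, hC, S₀, hGap⟩ := hA r hr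
  have hρ : 0 < ρ := lt_of_le_of_lt hκ hκρ
  -- an aspect ratio `θ` with `3 C θ^ρ ≤ 1/2`
  set b : ℝ := 1 / (2 * (3 * C + 1)) with hb
  have hb0 : 0 < b := by positivity
  have hb1 : b < 1 := by
    rw [hb, div_lt_one (by positivity)]; linarith
  set θ : ℝ := b ^ (1 / ρ) with hθ
  have hθ0 : 0 < θ := Real.rpow_pos_of_pos hb0 _
  have hθ1 : θ < 1 := Real.rpow_lt_one hb0.le hb1 (by positivity)
  have hθρ : θ ^ ρ = b := by rw [hθ, one_div, Real.rpow_inv_rpow hb0.le hρ.ne']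
  have hCθ : 3 * C * θ ^ ρ ≤ 1 / 2 := by
    rw [hθρ, hb, mul_one_div, div_le_div_iff₀ (by positivity) (by norm_num)]
    linarith
  obtain ⟨c₀, hc₀, r₀, hE2'⟩ := hE2 θ hθ0 hθ1.le
  have hsbar1 : 1 ≤ sbar := hr.trans hsbar
  have hsbar0 : 0 ≤ sbar := zero_le_one.trans hsbar1
  -- the constant in front of `S^(κ-ρ)` and the choice of `S₂`
  set K : ℝ := 2 * C * sbar ^ ρ / c₀ with hK
  have hlim : Tendsto (fun S : ℝ => K * S ^ (κ - ρ)) atTop (𝓝 0) := by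
    have h := (tendsto_rpow_neg_atTop (y := ρ - κ) (by linarith)).const_mul K
    rw [mul_zero] at h
    refine h.congr' (Eventually.of_forall fun S => ?_)
    simp only [neg_sub]
  obtain ⟨R, hR⟩ := eventually_atTop.1 ((tendsto_order.1 hlim).2 δ hδ)
  refine ⟨max (max S₀ r₀) (max (sbar / θ) R), ?_⟩
  intro S hS Λ a hΛ ha hdeep hwin
  have hS₀ : S₀ ≤ S := le_trans (le_trans (le_max_left _ _) (le_max_left _ _)) hS
  have hr₀ : r₀ ≤ S := le_trans (le_trans (le_max_right _ _) (le_max_left _ _)) hS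
  have hSθ : sbar / θ ≤ S := le_trans (le_trans (le_max_left _ _) (le_max_right _ _)) hS
  have hSR : R ≤ S := le_trans (le_trans (le_max_right _ _) (le_max_right _ _)) hS
  have hθS : sbar ≤ θ * S := by rwa [div_le_iff₀ hθ0, mul_comm] at hSθ
  have hS0 : 0 < S := by
    have : 0 < θ * S := lt_of_lt_of_le (lt_of_lt_of_le zero_lt_one hsbar1) hθS
    exact pos_of_mul_pos_right this hθ0.le
  have hθSS : θ * S ≤ S := mul_le_of_le_one_left hS0.le hθ1.le
  have hsbarS : sbar ≤ S := hθS.trans hθSS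
  have hrθS : r ≤ θ * S := hsbar.trans hθS
  have hball : latticeBall S ⊆ Λ := CoherenceBridge.latticeBall_subset hS0.le hdeep
  have hO : O ∈ Λ := hball (Reduction.O_mem_latticeBall hS0.le)
  -- abbreviations for the three weights
  set f : Picture → ℝ := fun P => ‖amp Λ a S P‖ * innerMass r S P with hf
  set p : Picture → ℝ := fun P => ‖amp Λ a S P‖ * portMass S P with hp
  set g : Picture → ℝ := fun P => ‖amp Λ a S P‖ * ‖picMono S P‖ with hg
  have hf0 : ∀ P, 0 ≤ f P := fun P => mul_nonneg (norm_nonneg _) (innerMass_nonneg _ _ _)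
  have hp0 : ∀ P, 0 ≤ p P := fun P => mul_nonneg (norm_nonneg _) (portMass_nonneg _ _)
  have hg0 : ∀ P, 0 ≤ g P := fun P => mul_nonneg (norm_nonneg _) (norm_nonneg _)
  -- step 0: the left side is dominated by the unsigned inner masses
  have hL : (∑ P ∈ (Pic S).filter (fun P => ¬ Clean sbar P),
      ‖amp Λ a S P‖ * ∑ e ∈ innerEdges r, ‖picField S P e‖) ≤
        ∑ P ∈ (Pic S).filter (fun P => ¬ Clean sbar P), f P := by
    refine Finset.sum_le_sum fun P _ => ?_
    exact mul_le_mul_of_nonneg_left (Finset.sum_le_sum fun e _ => norm_picField_le_edgeMass S P e)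
      (norm_nonneg _)
  -- step 1: E1' at `t = sbar` and at `t = θ S`
  have hP₁ : (∑ P ∈ (Pic S).filter (fun P => ¬ Clean sbar P), f P) ≤
      C * (sbar / S) ^ ρ * ∑ P ∈ Pic S, p P :=
    hGap S hS₀ sbar hsbar hsbarS Λ a hΛ ha hdeep hwin
  have hP₂ : (∑ P ∈ (Pic S).filter (fun P => ¬ Clean (θ * S) P), f P) ≤
      C * (θ * S / S) ^ ρ * ∑ P ∈ Pic S, p P :=
    hGap S hS₀ (θ * S) hrθS hθSS Λ a hΛ ha hdeep hwin
  have hθSS' : θ * S / S = θ := by field_simp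
  rw [hθSS'] at hP₂
  -- step 2: split the total port weight at cleanliness `θ S`; absorb the unclean part (`portMass ≤ 3 innerMass`)
  have hsplit := Finset.sum_filter_add_sum_filter_not (Pic S) (fun P => Clean (θ * S) P) p
  have hpf : (∑ P ∈ (Pic S).filter (fun P => ¬ Clean (θ * S) P), p P) ≤
      3 * ∑ P ∈ (Pic S).filter (fun P => ¬ Clean (θ * S) P), f P := by
    rw [Finset.mul_sum]
    refine Finset.sum_le_sum fun P _ => ?_
    calc p P = ‖amp Λ a S P‖ * portMass S P := rfl
      _ ≤ ‖amp Λ a S P‖ * (3 * innerMass r S P) :=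
          mul_le_mul_of_nonneg_left (portMass_le_innerMass hr S P) (norm_nonneg _)
      _ = 3 * f P := by simp only [hf]; ring
  have hPall : (∑ P ∈ Pic S, p P) ≤ 2 * ∑ P ∈ (Pic S).filter (fun P => Clean (θ * S) P), p P := by
    have hnn : 0 ≤ ∑ P ∈ Pic S, p P := Finset.sum_nonneg fun P _ => hp0 P
    have h1 : (∑ P ∈ (Pic S).filter (fun P => ¬ Clean (θ * S) P), p P) ≤ 1 / 2 * ∑ P ∈ Pic S, p P := by
      calc (∑ P ∈ (Pic S).filter (fun P => ¬ Clean (θ * S) P), p P)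
          ≤ 3 * (C * θ ^ ρ * ∑ P ∈ Pic S, p P) :=
            hpf.trans (mul_le_mul_of_nonneg_left hP₂ (by norm_num))
        _ = 3 * C * θ ^ ρ * ∑ P ∈ Pic S, p P := by ring
        _ ≤ 1 / 2 * ∑ P ∈ Pic S, p P := mul_le_mul_of_nonneg_right hCθ hnn
    linarith [hsplit, h1]
  -- step 3: E2 — clean realisable pictures convert port mass into monopole at the price `c₀⁻¹ S^κ`
  have hE2S := hE2' S hr₀ Λ hΛ a ha O hO hdeep hwin nbA nbB nbC Reduction.isStar_O
  have hQ : (∑ P ∈ (Pic S).filter (fun P => Clean (θ * S) P), p P) ≤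
      c₀⁻¹ * S ^ κ * ∑ P ∈ (Pic S).filter (fun P => Clean (θ * S) P), g P := by
    rw [Finset.mul_sum]
    refine Finset.sum_le_sum fun P hPc => ?_
    rw [Finset.mem_filter] at hPc
    by_cases hamp : amp Λ a S P = 0
    · have : p P = 0 := by simp [hp, hamp]
      rw [this]
      exact mul_nonneg (mul_nonneg (inv_nonneg.2 hc₀.le) (Real.rpow_nonneg hS0.le _)) (hg0 P)
    · have key := cleanMonopole_toPic hE2S hball hPc.1 hamp hPc.2
      have hSk : S ^ (-κ) = (S ^ κ)⁻¹ := Real.rpow_neg hS0.le κ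
      have hSκ : 0 < S ^ κ := Real.rpow_pos_of_pos hS0 κ
      rw [hSk] at key
      have key' : portMass S P ≤ c₀⁻¹ * S ^ κ * ‖picMono S P‖ := by
        rw [← div_le_iff₀' (by positivity)]
        calc portMass S P / (c₀⁻¹ * S ^ κ) = c₀ * (S ^ κ)⁻¹ * portMass S P := by field_simp
          _ ≤ _ := key
      calc p P = ‖amp Λ a S P‖ * portMass S P := rfl
        _ ≤ ‖amp Λ a S P‖ * (c₀⁻¹ * S ^ κ * ‖picMono S P‖) :=
            mul_le_mul_of_nonneg_left key' (norm_nonneg _)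
        _ = c₀⁻¹ * S ^ κ * g P := by simp only [hg]; ring
  have hN : (∑ P ∈ (Pic S).filter (fun P => Clean (θ * S) P), g P) ≤ ∑ P ∈ Pic S, g P :=
    OneMouth.sum_filter_le_sum_of_nonneg _ _ _ fun P _ => hg0 P
  -- assemble
  have hNnn : 0 ≤ ∑ P ∈ Pic S, g P := Finset.sum_nonneg fun P _ => hg0 P
  have hpow : (sbar / S) ^ ρ * S ^ κ = sbar ^ ρ * S ^ (κ - ρ) := by
    rw [Real.div_rpow hsbar0 hS0.le, Real.rpow_sub hS0]
    field_simp
  have hKS : K * S ^ (κ - ρ) < δ := hR S hSR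
  calc (∑ P ∈ (Pic S).filter (fun P => ¬ Clean sbar P),
        ‖amp Λ a S P‖ * ∑ e ∈ innerEdges r, ‖picField S P e‖)
      ≤ C * (sbar / S) ^ ρ * ∑ P ∈ Pic S, p P := hL.trans hP₁
    _ ≤ C * (sbar / S) ^ ρ * (2 * (c₀⁻¹ * S ^ κ * ∑ P ∈ Pic S, g P)) := by
        have : 0 ≤ C * (sbar / S) ^ ρ := mul_nonneg hC (Real.rpow_nonneg (by positivity) _)
        refine mul_le_mul_of_nonneg_left (hPall.trans ?_) this
        exact mul_le_mul_of_nonneg_left (hQ.trans (mul_le_mul_of_nonneg_left hN (by positivity)))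
          (by norm_num)
    _ = K * S ^ (κ - ρ) * ∑ P ∈ Pic S, g P := by
        rw [hK]
        have : C * (sbar / S) ^ ρ * (2 * (c₀⁻¹ * S ^ κ * ∑ P ∈ Pic S, g P)) =
            2 * C / c₀ * ((sbar / S) ^ ρ * S ^ κ) * ∑ P ∈ Pic S, g P := by
          field_simp
        rw [this, hpow]
        ring
    _ ≤ δ * ∑ P ∈ Pic S, g P := mul_le_mul_of_nonneg_right hKS.le hNnn

end Summit.CriticalPhenomena.SAWScalingLimit.Theorems.InteriorFlattening.Liouville

end
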